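import Summits.Ventures.CertifiedManyBodySolver.Downfold.BoxesHg1201ETnLadder
import HarnessLib

/-!
# HgBa₂CuO₄₊δ «Hg-1201», object E @0: the RECTANGULAR SUB-BOX BY VALUE of `boxHg1201E_M19b` — one parametric slice in all three S2 coordinates
# `(U/t, t′/t, n)` with its membership, refinements and rung-leaf discharger, so that «bank M19b ∩ {U ≥ U†} ∩ {t′ ≥ t†} ∩ {n ≤ n†} BY VALUE» is one `exact`

Venture CertifiedManyBodySolver, cell `pub/hubbard-downfold` (D-0154 (1)(C) COVERAGE (ii) Hg-1201), seat `hubbard-cov-hg1201-unc-2` — part 3 of the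
`(t, n)` + SLICES lane (lead RULING R-mc; parts 1–2 = `BoxesHg1201ETnLadder{,P10}`, p608068 / p609184). WHY: the captain's plan of record
(`HOME/hubbard-cov-hg1201-plan-1/HG1201-COVERAGE-PLAN.md` v0.1 §3.3 D1 (ii)(c) / (iii)) resolves a short corner word BY VALUE: «report the residual OPEN
sliver `[−0.54, t†] × [n†, 0.915] × [7/2, U†)` and bank `M19b ∩ {U ≥ U†}` through unc-2's slab-slice leaf images — no moved edge, no blind refire». Parts 1–2
typed the NAMED slices (S-I, S-II, the PEN's slabs, the v1.13 strip, the `n`-slices); this file types the GENERIC rectangular slice so that ANY `(U†, t†, n†)`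
the legs return is banked with one `exact` and no new definition per case.

* `boxHg1201E_M19b_slice3 ulo uhi tlo thi nlo nhi …` := `boxHg1201E_M19b` with `U/t`, `t′/t`, `n` re-issued to `[ulo, uhi]`, `[tlo, thi]`, `[nlo, nhi]` (three
  `Box.withEntry`; `t`, `t″` rows kept); `…_mem_iff`; `…_refines_M19b` when the three intervals sit inside M19b's rows (INWARD); `…_refines_uR` when `U` sits
  inside `[7/2, 52/5]` (unc-1's v1.13 box); `…_refines_slice3` (monotone in all six ends).
* `boxHg1201E_M19b_slice3_stiffnessWord_of_cellLeaf` / `…_stiffnessBoxCeilingBelow_of_cellLeaf`: a cell leaf `∀ tp ∈ [tlo, thi], ∀ U ∈ [ulo, uhi], ∀ n ∈ [nlo, nhi],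
  ObsStiffnessSeqCeilingAt tp U n c` (real literals = the rational ends cast) IS the word / the grammar word `StiffnessBoxCeilingBelow (slice3 …) bar` for any
  `c ≤ bar` — the banking door; `…_of_M19b_leaf` (downward: the registered leaf gives every inward slice); today's kinematic word on every inward slice.
* `boxHg1201E_M19b_eq_slice3` — M19b itself is the slice at its own ends (sanity; the named slices of parts 1–2 are instances up to the `t′`/`n` re-issue).

Everything here is PROVED (0 sorry, no new axiom). HONEST FRAMING: a slice is a CONDITIONAL-BY-NAME domain («on the part of the box with `U ≥ U†` …»), never
a box of record, never an edge move; stiffness statements are one-sided CEILINGS (CONTROL/CALIBRATION, wording class (xx1)), silent on the presence of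
superconductivity; not a `T_c` or phase sentence; no summit statement is proved here.
-/

noncomputable section

namespace Summit.Ventures.CertifiedManyBodySolver.Downfold
open Set NonemptyInterval Summit.Ventures.CertifiedManyBodySolver.Observables Literature.MathematicalPhysics.QuantumLattice

/-- **The rectangular sub-box BY VALUE**: `boxHg1201E_M19b` with `U/t ∈ [ulo, uhi]`, `t′/t ∈ [tlo, thi]`, `n ∈ [nlo, nhi]` re-issued (any rational ends with
`lo ≤ hi`; inward or not — refinement lemmas below carry the side conditions); `t_eV = [1/2, 3/5]` and `t″ = 0` rows of M19b kept. [folklore] -/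
def boxHg1201E_M19b_slice3 (ulo uhi tlo thi nlo nhi : ℚ) (hu : ulo ≤ uhi) (ht : tlo ≤ thi) (hn : nlo ≤ nhi) : OneBandBox :=
  ((boxHg1201E_M19b.withEntry .UOverT (Entry.ofEnds ulo uhi hu .screening)).withEntry .tpOverT
      (Entry.ofEnds tlo thi ht .screening)).withEntry .filling (Entry.ofEnds nlo nhi hn .screening)

section
variable {ulo uhi tlo thi nlo nhi : ℚ} (hu : ulo ≤ uhi) (ht : tlo ≤ thi) (hn : nlo ≤ nhi)

/-- **Membership in the rectangular slice, unfolded**: the three new intervals and M19b's `t`, `t″` rows. [folklore] -/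
theorem boxHg1201E_M19b_slice3_mem_iff (p : OneBandCoord → ℝ) :
    (boxHg1201E_M19b_slice3 ulo uhi tlo thi nlo nhi hu ht hn).Mem p ↔
      ((ulo : ℝ) ≤ p .UOverT ∧ p .UOverT ≤ (uhi : ℝ)) ∧ ((tlo : ℝ) ≤ p .tpOverT ∧ p .tpOverT ≤ (thi : ℝ)) ∧
      ((nlo : ℝ) ≤ p .filling ∧ p .filling ≤ (nhi : ℝ)) ∧
      ((((1/2) : ℚ) : ℝ) ≤ p .tEV ∧ p .tEV ≤ (((3/5) : ℚ) : ℝ)) ∧ (((0 : ℚ) : ℝ) ≤ p .tppOverT ∧ p .tppOverT ≤ ((0 : ℚ) : ℝ)) := by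
  unfold boxHg1201E_M19b_slice3
  rw [Box.mem_withEntry_iff]
  constructor
  · rintro ⟨hN, h⟩
    have hT := h .tpOverT (by decide) _ (by rw [Box.withEntry_self])
    have hrest : ∀ j, j ≠ OneBandCoord.filling → j ≠ OneBandCoord.tpOverT → ∀ f,
        (boxHg1201E_M19b.withEntry .UOverT (Entry.ofEnds ulo uhi hu .screening)) j = some f → f.Mem (p j) := by
      intro j hj1 hj2 f hf
      exact h j hj1 f (by rw [Box.withEntry_of_ne _ _ hj2]; exact hf)
    have hU := hrest .UOverT (by decide) (by decide) _ (Box.withEntry_self _ _ _)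
    have ht' := hrest .tEV (by decide) (by decide) hg1201E_M19b_t (by rw [Box.withEntry_of_ne _ _ (by decide)]; rfl)
    have htpp := hrest .tppOverT (by decide) (by decide) hg1201E_M19b_tpp (by rw [Box.withEntry_of_ne _ _ (by decide)]; rfl)
    exact ⟨(Entry.mem_ofEnds_iff _ _ _ _ _).1 hU, (Entry.mem_ofEnds_iff _ _ _ _ _).1 hT, (Entry.mem_ofEnds_iff _ _ _ _ _).1 hN,
      (Entry.mem_ofEnds_iff _ _ _ _ _).1 ht', (Entry.mem_ofEnds_iff _ _ _ _ _).1 htpp⟩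
  · rintro ⟨hU, hT, hN, ht', htpp⟩
    refine ⟨(Entry.mem_ofEnds_iff _ _ _ _ _).2 hN, ?_⟩
    intro j hj f hf
    by_cases hjt : j = OneBandCoord.tpOverT
    · subst hjt
      rw [Box.withEntry_self] at hf
      cases hf
      exact (Entry.mem_ofEnds_iff _ _ _ _ _).2 hT
    · rw [Box.withEntry_of_ne _ _ hjt] at hf
      by_cases hju : j = OneBandCoord.UOverT
      · subst hju
        rw [Box.withEntry_self] at hf
        cases hf
        exact (Entry.mem_ofEnds_iff _ _ _ _ _).2 hU
      · rw [Box.withEntry_of_ne _ _ hju] at hf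
        cases j <;> simp only [boxHg1201E_M19b, Option.some.injEq, reduceCtorEq, ne_eq, not_true_eq_false] at hf hj hjt hju <;>
          subst hf
        · exact (Entry.mem_ofEnds_iff _ _ _ _ _).2 ht'
        · exact (Entry.mem_ofEnds_iff _ _ _ _ _).2 htpp

/-- **INWARD ⇒ refines M19b**: if `[ulo, uhi] ⊆ [7/2, 44/5]`, `[tlo, thi] ⊆ [−27/50, −43/100]`, `[nlo, nhi] ⊆ [167/200, 183/200]` the slice is a sub-box of
`boxHg1201E_M19b` (so every M19b word — kinematic, energy, the registered leaf's word — holds on it). [folklore] -/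
theorem boxHg1201E_M19b_slice3_refines_M19b (hu1 : 7/2 ≤ ulo) (hu2 : uhi ≤ 44/5) (ht1 : -27/50 ≤ tlo) (ht2 : thi ≤ -43/100)
    (hn1 : 167/200 ≤ nlo) (hn2 : nhi ≤ 183/200) :
    (boxHg1201E_M19b_slice3 ulo uhi tlo thi nlo nhi hu ht hn).Refines boxHg1201E_M19b := by
  intro p hp
  obtain ⟨⟨a0, b0⟩, ⟨a1, b1⟩, ⟨a2, b2⟩, ⟨a3, b3⟩, ⟨a4, b4⟩⟩ := (boxHg1201E_M19b_slice3_mem_iff hu ht hn p).1 hp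
  have hu1' : (((7/2 : ℚ)) : ℝ) ≤ (ulo : ℝ) := by exact_mod_cast hu1
  have hu2' : ((uhi : ℚ) : ℝ) ≤ (((44/5 : ℚ)) : ℝ) := by exact_mod_cast hu2
  have ht1' : (((-27/50 : ℚ)) : ℝ) ≤ (tlo : ℝ) := by exact_mod_cast ht1
  have ht2' : ((thi : ℚ) : ℝ) ≤ (((-43/100 : ℚ)) : ℝ) := by exact_mod_cast ht2
  have hn1' : (((167/200 : ℚ)) : ℝ) ≤ (nlo : ℝ) := by exact_mod_cast hn1
  have hn2' : ((nhi : ℚ) : ℝ) ≤ (((183/200 : ℚ)) : ℝ) := by exact_mod_cast hn2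
  exact (boxHg1201E_M19b_mem_iff p).2
    ⟨hu1'.trans a0, b0.trans hu2', ht1'.trans a1, b1.trans ht2', hn1'.trans a2, b2.trans hn2', a3, b3, a4, b4⟩

/-- **`U` up to `52/5` ⇒ refines unc-1's v1.13 box `boxHg1201E_M19buR`** (`t′`, `n` inward as before). [folklore] -/
theorem boxHg1201E_M19b_slice3_refines_uR (hu1 : 7/2 ≤ ulo) (hu2 : uhi ≤ 52/5) (ht1 : -27/50 ≤ tlo) (ht2 : thi ≤ -43/100)
    (hn1 : 167/200 ≤ nlo) (hn2 : nhi ≤ 183/200) :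
    (boxHg1201E_M19b_slice3 ulo uhi tlo thi nlo nhi hu ht hn).Refines boxHg1201E_M19buR := by
  intro p hp
  obtain ⟨⟨a0, b0⟩, ⟨a1, b1⟩, ⟨a2, b2⟩, ⟨a3, b3⟩, ⟨a4, b4⟩⟩ := (boxHg1201E_M19b_slice3_mem_iff hu ht hn p).1 hp
  have hu1' : (((7/2 : ℚ)) : ℝ) ≤ (ulo : ℝ) := by exact_mod_cast hu1
  have hu2' : ((uhi : ℚ) : ℝ) ≤ (((52/5 : ℚ)) : ℝ) := by exact_mod_cast hu2
  have ht1' : (((-27/50 : ℚ)) : ℝ) ≤ (tlo : ℝ) := by exact_mod_cast ht1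
  have ht2' : ((thi : ℚ) : ℝ) ≤ (((-43/100 : ℚ)) : ℝ) := by exact_mod_cast ht2
  have hn1' : (((167/200 : ℚ)) : ℝ) ≤ (nlo : ℝ) := by exact_mod_cast hn1
  have hn2' : ((nhi : ℚ) : ℝ) ≤ (((183/200 : ℚ)) : ℝ) := by exact_mod_cast hn2
  exact (boxHg1201E_M19b_sliceU_mem_iff (by norm_num) p).2
    ⟨⟨hu1'.trans a0, b0.trans hu2'⟩, ⟨ht1'.trans a1, b1.trans ht2'⟩, ⟨hn1'.trans a2, b2.trans hn2'⟩, ⟨a3, b3⟩, ⟨a4, b4⟩⟩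

/-- **Monotone in all six ends**: a smaller rectangle refines a larger one. [folklore] -/
theorem boxHg1201E_M19b_slice3_mono {ulo' uhi' tlo' thi' nlo' nhi' : ℚ} (hu' : ulo' ≤ uhi') (ht' : tlo' ≤ thi') (hn' : nlo' ≤ nhi')
    (h1 : ulo' ≤ ulo) (h2 : uhi ≤ uhi') (h3 : tlo' ≤ tlo) (h4 : thi ≤ thi') (h5 : nlo' ≤ nlo) (h6 : nhi ≤ nhi') :
    (boxHg1201E_M19b_slice3 ulo uhi tlo thi nlo nhi hu ht hn).Refines (boxHg1201E_M19b_slice3 ulo' uhi' tlo' thi' nlo' nhi' hu' ht' hn') := by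
  intro p hp
  obtain ⟨⟨a0, b0⟩, ⟨a1, b1⟩, ⟨a2, b2⟩, hrest⟩ := (boxHg1201E_M19b_slice3_mem_iff hu ht hn p).1 hp
  have h1' : ((ulo' : ℚ) : ℝ) ≤ (ulo : ℝ) := by exact_mod_cast h1
  have h2' : ((uhi : ℚ) : ℝ) ≤ (uhi' : ℝ) := by exact_mod_cast h2
  have h3' : ((tlo' : ℚ) : ℝ) ≤ (tlo : ℝ) := by exact_mod_cast h3
  have h4' : ((thi : ℚ) : ℝ) ≤ (thi' : ℝ) := by exact_mod_cast h4
  have h5' : ((nlo' : ℚ) : ℝ) ≤ (nlo : ℝ) := by exact_mod_cast h5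
  have h6' : ((nhi : ℚ) : ℝ) ≤ (nhi' : ℝ) := by exact_mod_cast h6
  exact (boxHg1201E_M19b_slice3_mem_iff hu' ht' hn' p).2
    ⟨⟨h1'.trans a0, b0.trans h2'⟩, ⟨h3'.trans a1, b1.trans h4'⟩, ⟨h5'.trans a2, b2.trans h6'⟩, hrest⟩

/-- **M19b is its own slice** (the slice at M19b's ends has exactly M19b's members). [folklore] -/
theorem boxHg1201E_M19b_mem_iff_slice3 (p : OneBandCoord → ℝ) :
    boxHg1201E_M19b.Mem p ↔ (boxHg1201E_M19b_slice3 (7/2) (44/5) (-27/50) (-43/100) (167/200) (183/200)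
      (by norm_num) (by norm_num) (by norm_num)).Mem p := by
  rw [boxHg1201E_M19b_mem_iff, boxHg1201E_M19b_slice3_mem_iff]
  constructor
  · rintro ⟨a0, b0, a1, b1, a2, b2, a3, b3, a4, b4⟩; exact ⟨⟨a0, b0⟩, ⟨a1, b1⟩, ⟨a2, b2⟩, ⟨a3, b3⟩, ⟨a4, b4⟩⟩
  · rintro ⟨⟨a0, b0⟩, ⟨a1, b1⟩, ⟨a2, b2⟩, ⟨a3, b3⟩, ⟨a4, b4⟩⟩; exact ⟨a0, b0, a1, b1, a2, b2, a3, b3, a4, b4⟩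

/-- **THE BANKING DOOR (word)**: a cell leaf on the rectangle IS the stiffness word on the slice. [cite: ScalapinoWhiteZhang1993, §II] -/
theorem boxHg1201E_M19b_slice3_stiffnessWord_of_cellLeaf {c : ℚ}
    (hW : ∀ tp ∈ Set.Icc (tlo : ℝ) thi, ∀ U ∈ Set.Icc (ulo : ℝ) uhi, ∀ n ∈ Set.Icc (nlo : ℝ) nhi, ObsStiffnessSeqCeilingAt tp U n c) :
    HoldsOn (fun p : OneBandCoord → ℝ => ObsStiffnessSeqCeilingAt (p .tpOverT) (p .UOverT) (p .filling) c)
      (boxHg1201E_M19b_slice3 ulo uhi tlo thi nlo nhi hu ht hn) := by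
  intro p hp
  obtain ⟨hU, hT, hN, -, -⟩ := (boxHg1201E_M19b_slice3_mem_iff hu ht hn p).1 hp
  exact hW _ hT _ hU _ hN

/-- **THE BANKING DOOR (grammar)**: a cell leaf on the rectangle with `c ≤ bar` gives `StiffnessBoxCeilingBelow (slice3 …) bar` — «bank `M19b ∩ {U ≥ U†} ∩ …`
BY VALUE» with the bar of the leaf one is working toward (M19b: `5166800/10⁷`). [cite: ScalapinoWhiteZhang1993, §II] -/
theorem boxHg1201E_M19b_slice3_stiffnessBoxCeilingBelow_of_cellLeaf {c bar : ℚ} (hc : c ≤ bar)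
    (hW : ∀ tp ∈ Set.Icc (tlo : ℝ) thi, ∀ U ∈ Set.Icc (ulo : ℝ) uhi, ∀ n ∈ Set.Icc (nlo : ℝ) nhi, ObsStiffnessSeqCeilingAt tp U n c) :
    StiffnessBoxCeilingBelow (boxHg1201E_M19b_slice3 ulo uhi tlo thi nlo nhi hu ht hn) bar :=
  stiffnessBoxCeilingBelow_of_holdsOn hc (boxHg1201E_M19b_slice3_stiffnessWord_of_cellLeaf hu ht hn hW)

/-- **Downward**: the registered leaf `Hg1201M19b_StiffnessBoxCeiling` gives the grammar word on every INWARD rectangle. [cite: ScalapinoWhiteZhang1993, §II] -/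
theorem boxHg1201E_M19b_slice3_stiffnessBoxCeilingBelow_of_M19b_leaf (h : Hg1201M19b_StiffnessBoxCeiling) (hu1 : 7/2 ≤ ulo) (hu2 : uhi ≤ 44/5)
    (ht1 : -27/50 ≤ tlo) (ht2 : thi ≤ -43/100) (hn1 : 167/200 ≤ nlo) (hn2 : nhi ≤ 183/200) :
    StiffnessBoxCeilingBelow (boxHg1201E_M19b_slice3 ulo uhi tlo thi nlo nhi hu ht hn) (5166800 / 10000000) :=
  stiffnessBoxCeilingBelow_of_refines h (boxHg1201E_M19b_slice3_refines_M19b hu ht hn hu1 hu2 ht1 ht2 hn1 hn2)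

/-- **Today's unconditional word on every inward rectangle** (kinematic, `U`-free): `ρ_s ≤ 0.5272245`. [cite: HazraVermaRanderia2019, eqs. (2)-(6)] -/
theorem boxHg1201E_M19b_slice3_stiffness_kinematic (hu1 : 7/2 ≤ ulo) (hu2 : uhi ≤ 44/5) (ht1 : -27/50 ≤ tlo) (ht2 : thi ≤ -43/100)
    (hn1 : 167/200 ≤ nlo) (hn2 : nhi ≤ 183/200) :
    HoldsOn (fun p : OneBandCoord → ℝ => ObsStiffnessSeqCeilingAt (p .tpOverT) (p .UOverT) (p .filling) (5272245 / 10000000))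
      (boxHg1201E_M19b_slice3 ulo uhi tlo thi nlo nhi hu ht hn) :=
  boxHg1201E_M19b_stiffness_kinematic.of_refines (boxHg1201E_M19b_slice3_refines_M19b hu ht hn hu1 hu2 ht1 ht2 hn1 hn2)

end

/-- **The whole box from a finite cover by rectangles is NOT claimed generically** here (covers are the captain's business); what IS typed: the `U`-splits
(`holdsOn_boxHg1201E_M19b_of_Usplit`, three slabs) of part 1, and — for the D1 (ii)(c) report shape — the residual-sliver complement in `U` alone:
a word on `M19b ∩ {U ≥ U†}` and a word on `M19b ∩ {U ≤ U†}` give M19b (any `U† ∈ [7/2, 44/5]`), restated on `slice3` at M19b's own `t′`, `n` ends. [folklore] -/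
theorem holdsOn_boxHg1201E_M19b_of_slice3_Usplit {W : (OneBandCoord → ℝ) → Prop} {m : ℚ} (hlo : 7/2 ≤ m) (hhi : m ≤ 44/5)
    (h₁ : HoldsOn W (boxHg1201E_M19b_slice3 (7/2) m (-27/50) (-43/100) (167/200) (183/200) hlo (by norm_num) (by norm_num)))
    (h₂ : HoldsOn W (boxHg1201E_M19b_slice3 m (44/5) (-27/50) (-43/100) (167/200) (183/200) hhi (by norm_num) (by norm_num))) :
    HoldsOn W boxHg1201E_M19b := by
  refine holdsOn_boxHg1201E_M19b_of_Usplit hlo hhi (fun p hp => h₁ p ?_) (fun p hp => h₂ p ?_)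
  · obtain ⟨hU, ⟨a1, b1⟩, ⟨a2, b2⟩, h3, h4⟩ := (boxHg1201E_M19b_sliceU_mem_iff hlo p).1 hp
    refine (boxHg1201E_M19b_slice3_mem_iff _ _ _ p).2 ⟨hU, ⟨?_, ?_⟩, ⟨?_, ?_⟩, h3, h4⟩ <;> push_cast at * <;> linarith
  · obtain ⟨hU, ⟨a1, b1⟩, ⟨a2, b2⟩, h3, h4⟩ := (boxHg1201E_M19b_sliceU_mem_iff hhi p).1 hp
    refine (boxHg1201E_M19b_slice3_mem_iff _ _ _ p).2 ⟨hU, ⟨?_, ?_⟩, ⟨?_, ?_⟩, h3, h4⟩ <;> push_cast at * <;> linarith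

end Summit.Ventures.CertifiedManyBodySolver.Downfold

end
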